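import Summits.ResolutionOfSingularities.ResolutionOfSingularities.Theses.Valuative
import Summits.ResolutionOfSingularities.ResolutionOfSingularities.Theorems.ValuativeLuAlphaPTorsorDimTwo
import Summits.ResolutionOfSingularities.ResolutionOfSingularities.Theorems.ValuativeLuAlphaPTorsorAbhyankarPlace
import Summits.ResolutionOfSingularities.ResolutionOfSingularities.Theorems.ValuativeLuAlphaPTorsorClosedPointReduction
import Summits.ResolutionOfSingularities.ResolutionOfSingularities.Theorems.ValuativeLuAlphaPTorsorDiscreteAllDim
import Summits.ResolutionOfSingularities.ResolutionOfSingularities.Theorems.ValuativeLuAlphaPTorsorZeroDimReduction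
import Summits.ResolutionOfSingularities.ResolutionOfSingularities.Theorems.ValuativeLuAlphaPTorsorKnownRanges
import Summits.ResolutionOfSingularities.ResolutionOfSingularities.Theorems.ValuativeLuAlphaPTorsorAbhyankarTransfer
import Summits.ResolutionOfSingularities.ResolutionOfSingularities.Theorems.ValuativeLuAlphaPTorsorAbhyankarResidueExit
import Summits.ResolutionOfSingularities.ResolutionOfSingularities.Theorems.ValuativeLuAlphaPTorsorAbhyankarSepOfNotResidue
import Summits.ResolutionOfSingularities.ResolutionOfSingularities.Theorems.ValuativeLuAlphaPTorsorRankOne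
import Summits.ResolutionOfSingularities.ResolutionOfSingularities.Theorems.ValuativeLuAlphaPTorsorAdaptedDefs
import Summits.ResolutionOfSingularities.ResolutionOfSingularities.Theorems.ValuativeLuAlphaPTorsorAPFlagFinal
import Summits.ResolutionOfSingularities.ResolutionOfSingularities.Theorems.ValuativeLuAlphaPTorsorAdaptedValueStep
import Summits.ResolutionOfSingularities.ResolutionOfSingularities.Theorems.ValuativeLuAlphaPTorsorDenseKaplansky
import Summits.ResolutionOfSingularities.ResolutionOfSingularities.Theorems.ValuativeLuAlphaPTorsorDenseHenselRoot
import Summits.ResolutionOfSingularities.ResolutionOfSingularities.Theorems.ValuativeLuAlphaPTorsorDenseTranscendentalTower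
import Summits.ResolutionOfSingularities.ResolutionOfSingularities.Theorems.ValuativeLuAlphaPTorsorSeparablePrimitiveElement
import Summits.ResolutionOfSingularities.ResolutionOfSingularities.Theorems.ValuativeLuAlphaPTorsorDenseRangeAssembly
import Literature.AlgebraicGeometry.Resolution.CompositeValuations
import Literature.AlgebraicGeometry.Resolution.TranscendenceDefect
import Mathlib.Data.Matrix.Basic
import Mathlib.Algebra.Polynomial.AlgebraMap

/-!
# `LuAlphaPTorsor` along every valuation dense in an Abhyankar subfunction field (Knaf–Kuhlmann 2009, Thm. 1.5), and the crux's new core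

Crux `Valuative.LuAlphaPTorsor` (item `stmt-ResolutionOfSingularities-0641`), line
`pfaff-line-log-final-forms`, lead seat c6 (2026-08-17), reshape v6.5. The open core F⁶ᵃ of
v6.4 (zero-dimensional NON-Abhyankar valuations at closed centres of dimension `≥ 3`) is split
along Knaf–Kuhlmann 2009 (Adv. Math. 221 (2009) 428–453 = arXiv:math/0702856), Thm. 1.5: "if
`(F, P)` lies in the completion of a subfunction field `F₀` on which `P` is an Abhyankar place,
then `P` is strongly smoothly `K`-uniformizable — no extension of `F` is needed". The five stubs of
the dense case are PROVED in the tree (D1 `stub_denseKaplansky` p162656, D2 `stub_denseHenselRoot`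
p162908, D3 `stub_denseTranscendentalTower` p162780, D4 `stub_separablePrimitiveElement` p162645,
D5 `stub_denseRangeAssembly` p162855, on top of the tree's KK09 Lemma 3.9 / Lemma 3.7 (2) /
Cor. 3.6 / KK05 Thm. 1.1 / EGA IV 17.5.8); this file composes them BY NAME:

* `denseTranscendentalTower` — D3 fed with D1 (closed form);
* `denseRange` — **relative local uniformization along every valuation ring of `K/k` dense in a
  finitely generated subfield `F₀ ⊇ k` on which it is an Abhyankar place** (residue field of `F₀`
  separably generated over that of `k`, `K/F₀` separably generated): KK09 Thm. 1.5, first case, in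
  the crux's vocabulary — a TRUE RANGE strictly inside F⁶ᵃ (e.g. `k(x,y,z)` with `v(x) = 1`,
  `v(y) = √2`, `z` a transcendental series in `x^a y^b`: rank one, rational rank `2 < 3`,
  zero-dimensional, non-discrete, not Abhyankar, dense in the Abhyankar subfield `k(x,y)`);
* `denseRange_crux` — hence the crux's conclusion there;
* `luAlphaPTorsor_of_nonDenseCore` / `luAlphaPTorsor_iff_nonDenseCore` — the crux is EQUIVALENT
  to its **non-dense core** F⁷ (`stub_nonDenseCore` of the registered skeleton v6.5/v6.6): the
  v6.4 core with the extra hypothesis "NOT dense in any such Abhyankar subfunction field", i.e.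
  the valuations with non-finitely-generated value group, or residue field of infinite degree
  over `k`, or independent defect — the defect frontier of local uniformization in positive
  characteristic (dimension `3`: Cossart–Piltant; dimension `≥ 4`:
  `Literature.Barriers.ResolutionOfSingularities.DimensionFourFrontier`). A planner can file F⁷ as
  a statement item and close `stmt-0641` from it by `luAlphaPTorsor_of_nonDenseCore`.
-/

set_option linter.dupNamespace false

open IsLocalRing

namespace Summit.ResolutionOfSingularities.ResolutionOfSingularities.Theorems.PfaffLine

open Literature.AlgebraicGeometry.Resolution

/-- **The purely transcendental tower of the dense case, closed form** (D3 `stub_denseTranscendentalTower`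
fed with D1 `stub_denseKaplansky`): strong smooth `O_{K₀}`-uniformizability climbs from `F₀` to
`F₀(y₁,…,y_s)` for `y` algebraically independent over `F₀` inside a field dense over `F₀`.
[cite: KnafKuhlmann2009, Prop. 3.11 (proof)] -/
theorem denseTranscendentalTower :
    ∀ (Ω : Type) [Field Ω] (V : ValuationSubring Ω) (K₀ F₀ F : Subfield Ω) (s : ℕ) (y : Fin s → Ω), K₀ ≤ F₀ → F₀ ≤ F → (∀ i, y i ∈ F) → AlgebraicIndependent F₀ y → (∀ x ∈ F, ∀ w ∈ F, w ≠ 0 → ∃ a ∈ F₀, V.valuation (x - a) < V.valuation w) → (∀ Z : Finset Ω, (∀ z ∈ Z, z ∈ V ∧ z ∈ F₀) → Literature.AlgebraicGeometry.Resolution.IsSmoothlyUniformizableIn ↥(V.toSubring ⊓ K₀.toSubring) V F₀ (Z : Set Ω)) → ∀ Z : Finset Ω, (∀ z ∈ Z, z ∈ V ∧ z ∈ (IntermediateField.adjoin F₀ (Set.range y)).toSubfield) → Literature.AlgebraicGeometry.Resolution.IsSmoothlyUniformizableIn ↥(V.toSubring ⊓ K₀.toSubring) V (IntermediateField.adjoin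 F₀ (Set.range y)).toSubfield (Z : Set Ω) :=
  stub_denseTranscendentalTower stub_denseKaplansky

/-- **Knaf–Kuhlmann 2009, Thm. 1.5 (first case) in relative form — the dense-Abhyankar range.**
For a function field `K/k` and a valuation ring `O ⊇ k` of `K` such that `K` is dense (for `v`)
in a finitely generated subfield `F₀ ⊇ k` on which `O` is an Abhyankar place with separably
generated residue field extension, `K/F₀` separably generated: every finitely generated
`k`-subalgebra `S ⊆ O` is dominated by a finitely generated `A ⊆ O` with `Frac A = K`, regular at
the centre of `O`. Composition of D5 `stub_denseRangeAssembly` with D1, D2, D3, D4 (all PROVED).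
[cite: KnafKuhlmann2009, Thm. 1.5] -/
theorem denseRange :
    ∀ (k K : Type) [Field k] [Field K] [Algebra k K] (O : ValuationSubring K), (∀ c : k, algebraMap k K c ∈ O) → (⊤ : IntermediateField k K).FG → (∃ F₀ : Subfield K, (algebraMap k K).fieldRange ≤ F₀ ∧ Literature.AlgebraicGeometry.Resolution.FGOver (algebraMap k K).fieldRange F₀ ∧ Literature.AlgebraicGeometry.Resolution.IsAbhyankarPlace O (algebraMap k K).fieldRange F₀ ∧ Literature.AlgebraicGeometry.Resolution.SeparablyGeneratedOver (Literature.AlgebraicGeometry.Resolution.resField O (algebraMap k K).fieldRange) (Literature.AlgebraicGeometry.Resolution.resField O F₀) ∧ Literature.AlgebraicGeometry.Resolution.SeparablyGeneratedOver F₀ ⊤ ∧ ∀ x w : K, w ≠ 0 → ∃ a ∈ F₀, O.valuation (x - a) < O.valuation w) → ∀ (S : Subalgebra k K), S.FG → S.toSubring ≤ O.toSubring → ∃ (A : Subalgebra k K) (h : A.toSubring ≤ O.toSubring), S ≤ A ∧ A.FG ∧ IsFractionRing A K ∧ IsRegularLocalRing (Localization.AtPrime (Ideal.comap (Subring.inclusion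 h) (IsLocalRing.maximalIdeal O))) :=
  stub_denseRangeAssembly stub_denseKaplansky stub_denseHenselRoot denseTranscendentalTower
    stub_separablePrimitiveElement

/-- **The crux along the dense-Abhyankar range**: `LuAlphaPTorsor`'s conclusion for `A₀[t] ⊆ O`
whenever `K` is dense in an Abhyankar subfunction field (with separable data); the regularity of
`A₀` and the shape `t^p ∈ A₀` are not used. [cite: KnafKuhlmann2009, Thm. 1.5] -/
theorem denseRange_crux :
    ∀ p : ℕ, p.Prime → ∀ (k K : Type) [Field k] [CharP k p] [Field K] [Algebra k K] (O : ValuationSubring K) (A₀ : Subalgebra k K) (h₀ : A₀.toSubring ≤ O.toSubring) (t : K), A₀.FG → t ^ p ∈ A₀ → IsFractionRing (Algebra.adjoin k (insert t (A₀ : Set K))) K → (∃ F₀ : Subfield K, (algebraMap k K).fieldRange ≤ F₀ ∧ Literature.AlgebraicGeometry.Resolution.FGOver (algebraMap k K).fieldRange F₀ ∧ Literature.AlgebraicGeometry.Resolution.IsAbhyankarPlace O (algebraMap k K).fieldRange F₀ ∧ Literature.AlgebraicGeometry.Resolution.SeparablyGeneratedOver (Literature.AlgebraicGeometry.Resolution.resField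 O (algebraMap k K).fieldRange) (Literature.AlgebraicGeometry.Resolution.resField O F₀) ∧ Literature.AlgebraicGeometry.Resolution.SeparablyGeneratedOver F₀ ⊤ ∧ ∀ x w : K, w ≠ 0 → ∃ a ∈ F₀, O.valuation (x - a) < O.valuation w) → ∃ (A : Subalgebra k K) (h : A.toSubring ≤ O.toSubring), A₀ ≤ A ∧ t ∈ A ∧ A.FG ∧ IsFractionRing A K ∧ IsRegularLocalRing (Localization.AtPrime (Ideal.comap (Subring.inclusion h) (IsLocalRing.maximalIdeal O))) := by
  intro p hp k K _ _ _ _ O A₀ h₀ t hfg htp hfr hdense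
  classical
  have hk : ∀ c : k, algebraMap k K c ∈ O := fun c => h₀ (A₀.algebraMap_mem c)
  have htO : t ∈ O := mem_valuationSubring_of_pow_mem O hp.ne_zero (h₀ htp)
  obtain ⟨g, hg⟩ := hfg
  have hgA₀ : ∀ z ∈ g, z ∈ A₀ := fun z hz => by rw [← hg]; exact Algebra.subset_adjoin hz
  -- `K = k(g ∪ {t})`
  have htopfg : (⊤ : IntermediateField k K).FG := by
    refine ⟨insert t g, ?_⟩
    rw [eq_top_iff]
    intro z _
    haveI := hfr
    obtain ⟨a, b, -, rfl⟩ :=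
      IsFractionRing.div_surjective (A := Algebra.adjoin k (insert t (A₀ : Set K))) z
    have hle : Algebra.adjoin k (insert t (A₀ : Set K)) ≤
        (IntermediateField.adjoin k ((insert t g : Finset K) : Set K)).toSubalgebra := by
      rw [← hg, Algebra.adjoin_insert_adjoin, Finset.coe_insert]
      exact IntermediateField.algebra_adjoin_le_adjoin k _
    exact div_mem (hle a.2) (hle b.2)
  -- the subalgebra `S = A₀[t]`
  set S : Subalgebra k K := Algebra.adjoin k (insert t (A₀ : Set K)) with hS
  have hSfg : S.FG := by
    refine ⟨insert t g, ?_⟩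
    rw [hS, ← hg, Algebra.adjoin_insert_adjoin, Finset.coe_insert]
  let OA : Subalgebra k K :=
    { O.toSubring with algebraMap_mem' := fun c => hk c }
  have hSOA : S ≤ OA := by
    rw [hS]
    exact Algebra.adjoin_le (Set.insert_subset htO fun z hz => h₀ hz)
  have hSO : S.toSubring ≤ O.toSubring := fun z hz => hSOA hz
  obtain ⟨A, hAO, hSA, hAfg, hfrA, hreg⟩ := denseRange k K O hk htopfg hdense S hSfg hSO
  refine ⟨A, hAO, ?_, ?_, hAfg, hfrA, hreg⟩
  · intro z hz
    exact hSA (Algebra.subset_adjoin (Set.mem_insert_of_mem t hz))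
  · exact hSA (Algebra.subset_adjoin (Set.mem_insert t _))

/-- **The crux follows from its non-dense core** F⁷ (the registered signature of
`stub_nonDenseCore`, reshape v6.5, as hypothesis): reduce to closed-point centres and
zero-dimensional valuations, dispose of the birational case, the Abhyankar branches (separable
residue field of `K` or of `Frac A₀`, perfect `k`), base dimension `≤ 2`, a unit derivative,
discrete rank one, zero-dimensional Abhyankar places of rank one and of rank `≥ 2`, and the
dense-Abhyankar range `denseRange_crux` — all PROVED —, and hand the rest to the core.
[cite: KnafKuhlmann2009, Thm. 1.5] -/
theorem luAlphaPTorsor_of_nonDenseCore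
    (hcore : ∀ p : ℕ, p.Prime → ∀ (k K : Type) [Field k] [CharP k p] [Field K] [Algebra k K] (O : ValuationSubring K) (A₀ : Subalgebra k K) (h₀ : A₀.toSubring ≤ O.toSubring) (t : K), A₀.FG → ∀ (htp : t ^ p ∈ A₀), IsFractionRing (Algebra.adjoin k (insert t (A₀ : Set K))) K → IsRegularLocalRing (Localization.AtPrime (Ideal.comap (Subring.inclusion h₀) (IsLocalRing.maximalIdeal O))) → (Ideal.comap (Subring.inclusion h₀) (IsLocalRing.maximalIdeal O)).IsMaximal → (∀ x : K, x ∈ O → ∃ f : Polynomial k, f ≠ 0 ∧ Polynomial.aeval x f ∈ O.nonunits) → ¬ ringKrullDim (Localization.AtPrime (Ideal.comap (Subring.inclusion h₀) (IsLocalRing.maximalIdeal O))) ≤ 2 → ¬ Literature.AlgebraicGeometry.Resolution.IsAbhyankarPlace O (algebraMap k K).fieldRange ⊤ → ¬ (∃ F₀ : Subfield K, (algebraMap k K).fieldRange ≤ F₀ ∧ Literature.AlgebraicGeometry.Resolution.FGOver (algebraMap k K).fieldRange F₀ ∧ Literature.AlgebraicGeometry.Resolution.IsAbhyankarPlace O (algebraMap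 k K).fieldRange F₀ ∧ Literature.AlgebraicGeometry.Resolution.SeparablyGeneratedOver (Literature.AlgebraicGeometry.Resolution.resField O (algebraMap k K).fieldRange) (Literature.AlgebraicGeometry.Resolution.resField O F₀) ∧ Literature.AlgebraicGeometry.Resolution.SeparablyGeneratedOver F₀ ⊤ ∧ ∀ x w : K, w ≠ 0 → ∃ a ∈ F₀, O.valuation (x - a) < O.valuation w) → ¬ (∃ π : K, π ≠ 0 ∧ O.valuation π < 1 ∧ ∀ z : K, z ≠ 0 → ∃ n : ℤ, O.valuation z = O.valuation π ^ n) → (∀ δ : Derivation ℤ (Localization.AtPrime (Ideal.comap (Subring.inclusion h₀) (IsLocalRing.maximalIdeal O))) (Localization.AtPrime (Ideal.comap (Subring.inclusion h₀) (IsLocalRing.maximalIdeal O))), ¬ IsUnit (δ (algebraMap A₀.toSubring (Localization.AtPrime (Ideal.comap (Subring.inclusion h₀) (IsLocalRing.maximalIdeal O))) ⟨t ^ p, htp⟩))) → (∀ c : Localization.AtPrime (Ideal.comap (Subring.inclusion h₀) (IsLocalRing.maximalIdeal O)), algebraMap A₀.toSubring (Localization.AtPrime (Ideal.comap (Subring.inclusion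 h₀) (IsLocalRing.maximalIdeal O))) ⟨t ^ p, htp⟩ ≠ c ^ p) → ∃ (A : Subalgebra k K) (h : A.toSubring ≤ O.toSubring), A₀ ≤ A ∧ t ∈ A ∧ A.FG ∧ IsFractionRing A K ∧ IsRegularLocalRing (Localization.AtPrime (Ideal.comap (Subring.inclusion h) (IsLocalRing.maximalIdeal O)))) :
    Summit.ResolutionOfSingularities.ResolutionOfSingularities.Theses.Valuative.LuAlphaPTorsor := by
  classical
  intro p hp
  -- reduction to closed-point centres (stub G) and zero-dimensional valuations (stub G₂)
  refine stub_closedPointReduction p hp ?_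
  refine stub_zeroDimReduction p hp ?_
  intro k K _ _ _ _ O A₀ h₀ t hfg htp hfr hreg hmax hzd
  -- (0) the birational case
  by_cases hpow : ∃ c : Localization.AtPrime (Ideal.comap (Subring.inclusion h₀)
      (IsLocalRing.maximalIdeal O)), algebraMap A₀.toSubring (Localization.AtPrime
        (Ideal.comap (Subring.inclusion h₀) (IsLocalRing.maximalIdeal O))) ⟨t ^ p, htp⟩ = c ^ p
  · exact stub_birationalExit p hp k K O A₀ h₀ t hfg htp hfr hreg hpow
  push Not at hpow
  -- (1) Abhyankar places with separably generated residue extension of `K`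
  by_cases hAbh : Literature.AlgebraicGeometry.Resolution.IsAbhyankarPlace O (algebraMap k K).fieldRange ⊤ ∧
      Literature.AlgebraicGeometry.Resolution.SeparablyGeneratedOver
        (Literature.AlgebraicGeometry.Resolution.resField O (algebraMap k K).fieldRange)
        (Literature.AlgebraicGeometry.Resolution.resField O ⊤)
  · exact stub_abhyankarPlace p hp k K O A₀ h₀ t hfg htp hfr hAbh.1 hAbh.2
  -- (1') Abhyankar places with separably generated residue extension of the base `K₀`
  by_cases hAbh₀ : Literature.AlgebraicGeometry.Resolution.IsAbhyankarPlace O (algebraMap k K).fieldRange ⊤ ∧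
      Literature.AlgebraicGeometry.Resolution.SeparablyGeneratedOver
        (Literature.AlgebraicGeometry.Resolution.resField O (algebraMap k K).fieldRange)
        (Literature.AlgebraicGeometry.Resolution.resField O (Subfield.closure (A₀ : Set K)))
  · obtain ⟨hAK, hS₀⟩ := hAbh₀
    have hA₀K : Literature.AlgebraicGeometry.Resolution.IsAbhyankarPlace O
        (algebraMap k K).fieldRange (Subfield.closure (A₀ : Set K)) :=
      stub_abhyankarTransfer p hp k K O A₀ h₀ t htp hfr hAK
    by_cases hPf : ∃ c g : K, c ∈ Subfield.closure (A₀ : Set K) ∧ g ∈ Subfield.closure (A₀ : Set K) ∧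
        g ≠ 0 ∧ (t - c) / g ∈ O ∧
        ∀ z : K, z ∈ Subfield.closure (A₀ : Set K) → ¬ O.valuation ((t - c) / g - z) < 1
    · exact stub_abhyankarResidueExit p hp k K O A₀ h₀ t hfg htp hfr hA₀K hS₀ hPf
    · exact stub_abhyankarPlace p hp k K O A₀ h₀ t hfg htp hfr hAK
        (stub_abhyankarSepOfNotResidue p hp k K O A₀ h₀ t hfg htp hfr hreg hAK hS₀ hPf hpow)
  -- (1'') Abhyankar places over a PERFECT ground field (KK05 Thm 1.1 + Cor 2.2, landed)
  by_cases hAbhP : Literature.AlgebraicGeometry.Resolution.IsAbhyankarPlace O (algebraMap k K).fieldRange ⊤ ∧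
      PerfectField k
  · obtain ⟨hAK, hperf⟩ := hAbhP
    haveI := hperf
    exact luAlphaPTorsor_of_isAbhyankarPlace_of_perfectField p hp k K O A₀ h₀ t hfg htp hfr hAK
  -- (2) base dimension ≤ 2 at the centre (Mon_ν(2), Giraud 1983 along ν)
  by_cases hdim2 : ringKrullDim (Localization.AtPrime (Ideal.comap (Subring.inclusion h₀)
      (IsLocalRing.maximalIdeal O))) ≤ 2
  · exact luAlphaPTorsor_of_ringKrullDim_le_two p hp k K O A₀ h₀ t hfg htp hfr hreg hdim2
  -- (3) a unit derivative
  by_cases hδ : ∃ δ : Derivation ℤ (Localization.AtPrime (Ideal.comap (Subring.inclusion h₀)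
      (IsLocalRing.maximalIdeal O))) (Localization.AtPrime (Ideal.comap (Subring.inclusion h₀)
      (IsLocalRing.maximalIdeal O))), IsUnit (δ (algebraMap A₀.toSubring (Localization.AtPrime
        (Ideal.comap (Subring.inclusion h₀) (IsLocalRing.maximalIdeal O))) ⟨t ^ p, htp⟩))
  · exact luAlphaPTorsor_of_isUnit_derivation p hp k K O A₀ h₀ t hfg htp hfr hreg hδ
  push Not at hδ
  -- (4) DISCRETE rank-one valuations, every dimension (branch DiscreteAllDim, landed)
  by_cases hdisc : ∃ π : K, π ≠ 0 ∧ O.valuation π < 1 ∧ ∀ z : K, z ≠ 0 → ∃ n : ℤ, O.valuation z = O.valuation π ^ n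
  · exact luAlphaPTorsor_of_discrete p hp k K O A₀ h₀ t hfg htp hfr hreg hdisc
  -- (5) zero-dimensional, closed-point centre of dimension ≥ 3, non-discrete:
  --     Abhyankar places — RANK ONE (S6, landed) / rank ≥ 2 (F⁶ᵇ, landed) —, or non-Abhyankar
  by_cases hAK : Literature.AlgebraicGeometry.Resolution.IsAbhyankarPlace O (algebraMap k K).fieldRange ⊤
  · by_cases hr1 : ∀ z w : K, O.valuation z < 1 → w ≠ 0 → ∃ N : ℕ, O.valuation z ^ N < O.valuation w
    · exact stub_rankOneAbhyankar p hp k K O A₀ h₀ t hfg htp hfr hzd hAK hr1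
    · exact stub_abhyankarHigherRankCore p hp k K O A₀ h₀ t hfg htp hfr hreg hmax hzd hdim2 hAK hr1
        (fun h => hAbh ⟨hAK, h⟩) (fun h => hAbh₀ ⟨hAK, h⟩) (fun h => hAbhP ⟨hAK, h⟩) hdisc hδ hpow
  -- (6) non-Abhyankar: the DENSE-ABHYANKAR range (KK09 Thm 1.5; D1–D5), or the non-dense core F⁷
  by_cases hdense : (∃ F₀ : Subfield K, (algebraMap k K).fieldRange ≤ F₀ ∧ Literature.AlgebraicGeometry.Resolution.FGOver (algebraMap k K).fieldRange F₀ ∧ Literature.AlgebraicGeometry.Resolution.IsAbhyankarPlace O (algebraMap k K).fieldRange F₀ ∧ Literature.AlgebraicGeometry.Resolution.SeparablyGeneratedOver (Literature.AlgebraicGeometry.Resolution.resField O (algebraMap k K).fieldRange) (Literature.AlgebraicGeometry.Resolution.resField O F₀) ∧ Literature.AlgebraicGeometry.Resolution.SeparablyGeneratedOver F₀ ⊤ ∧ ∀ x w : K, w ≠ 0 → ∃ a ∈ F₀, O.valuation (x - a) < O.valuation w)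
  · exact denseRange_crux p hp k K O A₀ h₀ t hfg htp hfr hdense
  · exact hcore p hp k K O A₀ h₀ t hfg htp hfr hreg hmax hzd hdim2 hAK hdense hdisc hδ hpow

/-- **The crux is EQUIVALENT to its non-dense core** F⁷: the converse direction is the
instance of the crux at the core's data (the extra hypotheses are dropped). [folklore] -/
theorem luAlphaPTorsor_iff_nonDenseCore :
    Summit.ResolutionOfSingularities.ResolutionOfSingularities.Theses.Valuative.LuAlphaPTorsor ↔
    (∀ p : ℕ, p.Prime → ∀ (k K : Type) [Field k] [CharP k p] [Field K] [Algebra k K] (O : ValuationSubring K) (A₀ : Subalgebra k K) (h₀ : A₀.toSubring ≤ O.toSubring) (t : K), A₀.FG → ∀ (htp : t ^ p ∈ A₀), IsFractionRing (Algebra.adjoin k (insert t (A₀ : Set K))) K → IsRegularLocalRing (Localization.AtPrime (Ideal.comap (Subring.inclusion h₀) (IsLocalRing.maximalIdeal O))) → (Ideal.comap (Subring.inclusion h₀) (IsLocalRing.maximalIdeal O)).IsMaximal → (∀ x : K, x ∈ O → ∃ f : Polynomial k, f ≠ 0 ∧ Polynomial.aeval x f ∈ O.nonunits) → ¬ ringKrullDim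 (Localization.AtPrime (Ideal.comap (Subring.inclusion h₀) (IsLocalRing.maximalIdeal O))) ≤ 2 → ¬ Literature.AlgebraicGeometry.Resolution.IsAbhyankarPlace O (algebraMap k K).fieldRange ⊤ → ¬ (∃ F₀ : Subfield K, (algebraMap k K).fieldRange ≤ F₀ ∧ Literature.AlgebraicGeometry.Resolution.FGOver (algebraMap k K).fieldRange F₀ ∧ Literature.AlgebraicGeometry.Resolution.IsAbhyankarPlace O (algebraMap k K).fieldRange F₀ ∧ Literature.AlgebraicGeometry.Resolution.SeparablyGeneratedOver (Literature.AlgebraicGeometry.Resolution.resField O (algebraMap k K).fieldRange) (Literature.AlgebraicGeometry.Resolution.resField O F₀) ∧ Literature.AlgebraicGeometry.Resolution.SeparablyGeneratedOver F₀ ⊤ ∧ ∀ x w : K, w ≠ 0 → ∃ a ∈ F₀, O.valuation (x - a) < O.valuation w) → ¬ (∃ π : K, π ≠ 0 ∧ O.valuation π < 1 ∧ ∀ z : K, z ≠ 0 → ∃ n : ℤ, O.valuation z = O.valuation π ^ n) → (∀ δ : Derivation ℤ (Localization.AtPrime (Ideal.comap (Subring.inclusion h₀) (IsLocalRing.maximalIdeal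 O))) (Localization.AtPrime (Ideal.comap (Subring.inclusion h₀) (IsLocalRing.maximalIdeal O))), ¬ IsUnit (δ (algebraMap A₀.toSubring (Localization.AtPrime (Ideal.comap (Subring.inclusion h₀) (IsLocalRing.maximalIdeal O))) ⟨t ^ p, htp⟩))) → (∀ c : Localization.AtPrime (Ideal.comap (Subring.inclusion h₀) (IsLocalRing.maximalIdeal O)), algebraMap A₀.toSubring (Localization.AtPrime (Ideal.comap (Subring.inclusion h₀) (IsLocalRing.maximalIdeal O))) ⟨t ^ p, htp⟩ ≠ c ^ p) → ∃ (A : Subalgebra k K) (h : A.toSubring ≤ O.toSubring), A₀ ≤ A ∧ t ∈ A ∧ A.FG ∧ IsFractionRing A K ∧ IsRegularLocalRing (Localization.AtPrime (Ideal.comap (Subring.inclusion h) (IsLocalRing.maximalIdeal O)))) := by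
  refine ⟨fun h => ?_, luAlphaPTorsor_of_nonDenseCore⟩
  intro p hp k K _ _ _ _ O A₀ h₀ t hfg htp hfr hreg _ _ _ _ _ _ _ _
  exact h p hp k K O A₀ h₀ t hfg htp hfr hreg

end Summit.ResolutionOfSingularities.ResolutionOfSingularities.Theorems.PfaffLine
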